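import Summits.CriticalPhenomena.PercolationContinuityZ3.Theorems.PercNearOneGluingNoHeavyRsw3AnnulusTwoArmCriticalCellsAspect
import Summits.CriticalPhenomena.PercolationContinuityZ3.Theorems.PercNearOneGluingNoHeavyRsw3AnnulusTwoArmSeparationAspect
import Summits.CriticalPhenomena.PercolationContinuityZ3.Theorems.PercNearOneGluingNoHeavyRsw3AnnulusTwoArmFromBlocking
import HarnessLib

/-!
# RSW3 lane (P2, gen 13): the same-`p` criterion with plates ending ON the outer sphere (`R ≤ P + ρ`), and the positivity
# bound for the annulus two-arm probability at every aspect

builds on p205010 (kernel theorem, internal audit signed; external expert review pending)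

Cell `prim-rsw3`, prover seat `prim-rsw3-p2` (gen 13), memo `run/shared/lean/prim/rsw3/P2-RSWLITE.md` §20.
Support file (`--supports stmt-CriticalPhenomena-4575`); no definitions, no named facts, no sorries.

`…Rsw3AnnulusTwoArmCriticalCellsAspect` (`theta_pos_of_src_uniqZone_criterion_gen`) asks the far plane `{x₀ = P}` of the plates to lie STRICTLY
outside the outer ball of the uniqueness zone (`R + 1 ≤ P + ρ`).  For the single-scale theorem at aspect exactly `3` (V36) the plane lies ON the
sphere (`P = 2N`, `ρ = N`, `R = 3N`), which is just as good: a source-issued path to the plane either leaves the ball earlier (first exit) or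
stays inside and ends on its inner vertex boundary (`mem_toBdryAt_of_inConn_of_le`).  Hence `reachable_of_uniqZoneAt_src_sphere` and the
criterion `theta_pos_of_src_uniqZone_criterion_sphere` with `R ≤ P + ρ`.  Also the every-aspect positivity bound
`real_loc_sq_mul_one_sub_pow_le_annulusTwoArmProb` (`σ_loc(n,L)² (1-p)^{(2L+1)⁶} ≤ α₂(n,L)`, all pairs at the plane `{x₀ = 0}` closed), used for
the small scales of the every-aspect theorem (`…Rsw3AnnulusTwoArmCriticalAspect`).

References: M. Aizenman, Nucl. Phys. B 485 (1997) 551–582, §2 [Aizenman1997]; S. Martineau, V. Tassion, Ann. Probab. 45 (2017), §3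
[MartineauTassion2017]; G. Grimmett, *Percolation* (1999), §7.4 [GrimmettPercolation1999]. [folklore]
-/

noncomputable section

namespace Summit.CriticalPhenomena.PercolationContinuityZ3.Theorems.Rsw3

open MeasureTheory Literature.Probability.LatticeModels Literature.Probability.Percolation
open Literature.Probability.Percolation.KestenZhang Literature.Probability.Percolation.KozmaNitzan SimpleGraph Relation
open Summit.CriticalPhenomena.PercolationContinuityZ3.Theorems.Crossing SurfaceTension

/-! ## First exit, or arrival on the sphere -/

/-- **First exit OR arrival on the sphere.**  If `x ∈ Λ_v(R)` is joined inside some region `S` to a vertex `y` with `y₀ ≥ v₀ + R` (on or beyond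
the far face of the ball in direction `0`), then `toBdryAt v R x`: either the path leaves the ball (first exit) or it stays inside, and then
`y` itself lies on the inner vertex boundary (`y + e₀ ∉ Λ_v(R)`). [folklore] -/
theorem mem_toBdryAt_of_inConn_of_le {S : Set (Site 3)} {v x y : Site 3} {R : ℕ} {ω : BondConfig (Site 3)}
    (hx : x ∈ GM.ball v R) (hy : v 0 + (R : ℤ) ≤ y 0) (h : ω ∈ inConn S x y) : ω ∈ toBdryAt v R x := by
  classical
  by_cases hyB : y ∈ GM.ball v R
  · -- `y` on the sphere: walk inside the ball or first exit
    have h' := h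
    rw [mem_inConn_iff] at h'
    obtain ⟨W⟩ := h'
    have hH : openGraph ω ⊓ withinGraph (zdGraph 3) S ≤ zdGraph 3 := fun a b hab => (withinGraph_adj.1 hab.2).1
    by_cases hall : ∀ i, i ≤ W.length → W.getVert i ∈ GM.ball v R
    · -- the whole walk is inside the ball
      have hy0 : y 0 = v 0 + (R : ℤ) := by
        rw [GM.mem_ball] at hyB
        have := (hyB 0).2
        omega
      have hybd : y ∈ innerBoundary (zdGraph 3) (GM.ball v R) := by
        rw [mem_innerBoundary_iff]
        refine ⟨hyB, y + Pi.single 0 1, ?_, ?_⟩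
        · intro hmem
          rw [GM.mem_ball] at hmem
          have := (hmem 0).2
          simp at this
          omega
        · rw [zdGraph_adj_iff]; exact ⟨0, Or.inl rfl⟩
      refine ⟨y, hybd, ?_⟩
      have hin : ω ∈ inConn (↑(GM.ball v R) : Set (Site 3)) x y := by
        rw [mem_inConn_iff]
        have hreach := reachable_getVert_of_forall_mem hH W (↑(GM.ball v R) : Set (Site 3)) 0 W.length (by omega)
          (fun r _ h2 => Finset.mem_coe.2 (hall r (by omega)))
        rw [W.getVert_zero, zero_add, W.getVert_length] at hreach
        refine hreach.mono ?_
        intro a b hab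
        obtain ⟨⟨hopen, -⟩, hwithin⟩ := (SimpleGraph.inf_adj _ _ _ _).1 hab
        exact (SimpleGraph.inf_adj _ _ _ _).2 ⟨hopen, hwithin⟩
      exact mem_openConnIn_of_mem_inConn hx hin
    · -- some vertex is outside: first exit from the prefix walk
      push Not at hall
      obtain ⟨i, hi, hiB⟩ := hall
      have hpre : ω ∈ inConn S x (W.getVert i) := by
        rw [mem_inConn_iff]; exact ⟨W.take i |>.copy rfl (by simp)⟩
      exact mem_toBdryAt_of_inConn hx (fun hmem => hiB hmem) hpre
  · exact mem_toBdryAt_of_inConn hx hyB h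

/-! ## The gluing step with plates ending on the sphere -/

/-- **Gluing through `uniqZoneAt z_b ρ R` when the far plane may lie on the sphere** (`2m + 1 ≤ ρ ≤ R`, `R ≤ P + ρ`): as
`reachable_of_uniqZoneAt_src_gen`, with `mem_toBdryAt_of_inConn_of_le` in place of the strict first exit. [cite: MartineauTassion2017, proof of Lemma 3.7] -/
theorem reachable_of_uniqZoneAt_src_sphere {ρ R P m : ℕ} (hm : 2 * m + 1 ≤ ρ) (hρR : ρ ≤ R) (hP : R ≤ P + ρ)
    {b b' b'' : Site 2} (hbb' : supDist b b' ≤ 1) (hbb'' : supDist b b'' ≤ 1) {S S' : Set (Site 3)} {x y x' y' : Site 3}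
    {ω : BondConfig (Site 3)}
    (hU : ω ∈ uniqZoneAt ![-(ρ : ℤ), ((m : ℤ) + 1) * b 0, ((m : ℤ) + 1) * b 1] ρ R)
    (hx : x ∈ (Finset.Icc (0 : Site 3) ![((0 : ℕ) : ℤ), m, m]).image
      (· + ![0, ((m : ℤ) + 1) * b' 0, ((m : ℤ) + 1) * b' 1]))
    (hx' : x' ∈ (Finset.Icc (0 : Site 3) ![((0 : ℕ) : ℤ), m, m]).image
      (· + ![0, ((m : ℤ) + 1) * b'' 0, ((m : ℤ) + 1) * b'' 1]))
    (hy : y 0 = (P : ℤ)) (hy' : y' 0 = (P : ℤ))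
    (hxy : ω ∈ inConn S x y) (hx'y' : ω ∈ inConn S' x' y') :
    (openGraph ω).Reachable x x' := by
  have hx0 : x 0 = 0 := by
    have h := (mem_image_Icc_add_iff.1 hx) 0
    simp only [Matrix.cons_val_zero, Nat.cast_zero] at h
    omega
  have hx'0 : x' 0 = 0 := by
    have h := (mem_image_Icc_add_iff.1 hx') 0
    simp only [Matrix.cons_val_zero, Nat.cast_zero] at h
    omega
  have hxB := mem_ball_annCentre_of_mem_cell (n := 0) hm hbb' hx hx0
  have hx'B := mem_ball_annCentre_of_mem_cell (n := 0) hm hbb'' hx' hx'0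
  have hsub : ∀ {u : Site 3}, u ∈ GM.ball (![-(ρ : ℤ), ((m : ℤ) + 1) * b 0, ((m : ℤ) + 1) * b 1] : Site 3) ρ →
      u ∈ GM.ball (![-(ρ : ℤ), ((m : ℤ) + 1) * b 0, ((m : ℤ) + 1) * b 1] : Site 3) R := by
    intro u hu
    rw [GM.mem_ball] at hu ⊢
    intro i
    have := hu i
    have hρR' : (ρ : ℤ) ≤ R := by exact_mod_cast hρR
    constructor <;> linarith [this.1, this.2]
  have hP' : (R : ℤ) ≤ (P : ℤ) + (ρ : ℤ) := by exact_mod_cast hP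
  have hyv : (![-(ρ : ℤ), ((m : ℤ) + 1) * b 0, ((m : ℤ) + 1) * b 1] : Site 3) 0 + (R : ℤ) ≤ y 0 := by
    simp only [Matrix.cons_val_zero, hy]; linarith
  have hy'v : (![-(ρ : ℤ), ((m : ℤ) + 1) * b 0, ((m : ℤ) + 1) * b 1] : Site 3) 0 + (R : ℤ) ≤ y' 0 := by
    simp only [Matrix.cons_val_zero, hy']; linarith
  exact reachable_of_mem_openConnIn'
    (hU x hxB x' hx'B (mem_toBdryAt_of_inConn_of_le (hsub hxB) hyv hxy) (mem_toBdryAt_of_inConn_of_le (hsub hx'B) hy'v hx'y'))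

/-! ## The criterion with `R ≤ P + ρ` -/

/-- **Same-`p` criterion, plates ending on or beyond the sphere** (bond percolation on `ℤ³`, ANY `p`; `2m + 1 ≤ ρ ≤ R`, `R ≤ P + ρ`, `R ≤ k(m+1)`):
with `E₀`, `δ` as in `theta_pos_of_src_uniqZone_criterion_gen`, `P_p(E₀ᶜ) + P_p((uniqZone ρ R)ᶜ) ≤ δ^{(2k+1)²} ⇒ θ(p) > 0`.
[cite: Aizenman1997, §2 criterion (ii)] [cite: MartineauTassion2017, §3.3] -/
theorem theta_pos_of_src_uniqZone_criterion_sphere (p : unitInterval) {m ρ R P k : ℕ} (hm : 2 * m + 1 ≤ ρ) (hρR : ρ ≤ R)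
    (hP : R ≤ P + ρ) (hRk : R ≤ k * (m + 1))
    (h : (bondPercolation (zdGraph 3) p).real
          (linked
            (↑(Finset.Icc (![(0 : ℤ), -(((k : ℤ) - 1) * m), -(((k : ℤ) - 1) * m)] : Site 3)
              ![(P : ℤ), (k : ℤ) * m, (k : ℤ) * m]))
            (↑(Finset.Icc (0 : Site 3) ![((0 : ℕ) : ℤ), m, m]))
            (↑(Finset.Icc (![(P : ℤ), -(((k : ℤ) - 1) * m), -(((k : ℤ) - 1) * m)] : Site 3)
              ![(P : ℤ), (k : ℤ) * m, (k : ℤ) * m])))ᶜ +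
        (bondPercolation (zdGraph 3) p).real (uniqZone (d := 3) ρ R)ᶜ ≤
      (1 / (2 * ((2 * (k : ℝ) + 1) ^ 2 + 2) * (2 * (3 ^ 2 + 1 : ℝ) ^ 2) ^ ((2 * k + 1) ^ 2))) ^ ((2 * k + 1) ^ 2)) :
    0 < theta (zdGraph 3) (0 : Site 3) p := by

  classical
  -- the proof of `theta_pos_of_src_uniqZone_criterion_gen` verbatim, with the sphere gluing
  set μ := bondPercolation (zdGraph 3) p with hμ
  set δ : ℝ := 1 / (2 * ((2 * (k : ℝ) + 1) ^ 2 + 2) * (2 * (3 ^ 2 + 1 : ℝ) ^ 2) ^ ((2 * k + 1) ^ 2)) with hδ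
  set Wn : Finset (Site 3) := Finset.Icc (![(0 : ℤ), -(((k : ℤ) - 1) * m), -(((k : ℤ) - 1) * m)] : Site 3)
    ![(P : ℤ), (k : ℤ) * m, (k : ℤ) * m] with hWn
  set Q : Finset (Site 3) := Finset.Icc (0 : Site 3) ![((0 : ℕ) : ℤ), m, m] with hQ
  set Fp : Finset (Site 3) := Finset.Icc (![(P : ℤ), -(((k : ℤ) - 1) * m), -(((k : ℤ) - 1) * m)] : Site 3)
    ![(P : ℤ), (k : ℤ) * m, (k : ℤ) * m] with hFp
  set sh : Site 2 → Site 3 := fun b => ![0, ((m : ℤ) + 1) * b 0, ((m : ℤ) + 1) * b 1] with hsh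
  set z : Site 2 → Site 3 := fun b => ![-(ρ : ℤ), ((m : ℤ) + 1) * b 0, ((m : ℤ) + 1) * b 1] with hz
  set cell : Site 2 → Set (Site 3) := fun b => (zdShiftIso (sh b)) '' ↑Wn with hcell
  set src : Site 2 → Set (Site 3) := fun b => (zdShiftIso (sh b)) '' ↑Q with hsrc
  set far : Site 2 → Set (Site 3) := fun b => (zdShiftIso (sh b)) '' ↑Fp with hfar
  set good : Site 2 → Set (BondConfig (Site 3)) := fun b =>
    linked (cell b) (src b) (far b) ∩ uniqZoneAt (z b) ρ R with hgood
  have himgQ : ∀ b, src b = ↑(Q.image (· + sh b)) := by intro b; simp only [hsrc]; rw [Finset.coe_image]; rfl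
  have hsh0 : ∀ b, sh b 0 = 0 := fun b => by simp [hsh]
  have hfar0 : ∀ b, ∀ y ∈ far b, y 0 = (P : ℤ) := by
    intro b y hy
    simp only [hfar] at hy
    obtain ⟨y', hy', rfl⟩ := hy
    rw [Finset.mem_coe, hFp, Finset.mem_Icc] at hy'
    have h1 := hy'.1 0; have h2 := hy'.2 0
    simp at h1 h2
    rw [zdShiftIso_apply, Pi.add_apply, hsh0]
    omega
  have hδ0 : 0 ≤ δ := by rw [hδ]; positivity
  have hcast : (((2 * k : ℕ) : ℝ) + 1) = 2 * (k : ℝ) + 1 := by push_cast; ring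
  have hδ1 : 2 * ((((2 * k : ℕ) : ℝ) + 1) ^ 2 + 2) * (2 * (3 ^ 2 + 1 : ℝ) ^ 2) ^ ((2 * k + 1) ^ 2) * δ ≤ 1 := by
    rw [hcast]
    have hpos : 0 < 2 * ((2 * (k : ℝ) + 1) ^ 2 + 2) * (2 * (3 ^ 2 + 1 : ℝ) ^ 2) ^ ((2 * k + 1) ^ 2) := by positivity
    rw [hδ, mul_one_div_cancel hpos.ne']
  refine theta_pos_of_sparse_bound_src p (cell := cell) (src := src) (F₁ := {y | y 0 = (P : ℤ)}) (good := good)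
    (Q.image (· + sh 0)) (himgQ 0) ?_ ?_ ?_ ?_ (r := 2 * k) hδ0 hδ1 ?_
  · -- the patch is nonempty
    refine (Finset.image_nonempty).2 ⟨0, ?_⟩
    rw [hQ, Finset.mem_Icc]
    refine ⟨le_rfl, fun i => ?_⟩
    fin_cases i <;> simp
  · -- a regular patch is crossed from its source
    intro ω b hb
    obtain ⟨hcr, -⟩ := hb
    rw [mem_linked_iff] at hcr
    obtain ⟨x, hx, y, hy, hxy⟩ := hcr
    exact ⟨x, hx, y, hfar0 b y hy, hxy⟩
  · -- gluing of ★-neighbours through the uniqueness zone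
    intro ω b b' hbb' hb x hx x' hx' y hy y' hy' hxy hx'y'
    obtain ⟨-, hU⟩ := hb
    rw [himgQ b, Finset.mem_coe] at hx
    rw [himgQ b', Finset.mem_coe] at hx'
    have hbb : supDist b b ≤ 1 := supDist_le_iff.2 fun i => by simp
    exact reachable_of_uniqZoneAt_src_sphere hm hρR hP hbb hbb' hU hx hx' hy hy' hxy hx'y'
  · -- distinct patches are disjoint
    intro b b' x hx hx'
    rw [himgQ b, Finset.mem_coe] at hx
    rw [himgQ b', Finset.mem_coe] at hx'
    exact eq_of_mem_image_cell hx hx'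
  · -- the sparse product bound
    intro T hT
    have hcard := real_biInter_compl_good_gen p (ρ := ρ) (P := P) hRk T hT
    have hone : μ.real (linked (↑Wn : Set (Site 3)) ↑Q ↑Fp ∩ uniqZoneAt ![-(ρ : ℤ), 0, 0] ρ R)ᶜ ≤
        δ ^ ((2 * k + 1) ^ 2) :=
      (real_compl_good_le_gen p ρ R (↑Wn) (↑Q) (↑Fp) _).trans h
    have e : μ.real (⋂ b ∈ T, (good b)ᶜ) =
        μ.real (linked (↑Wn : Set (Site 3)) ↑Q ↑Fp ∩ uniqZoneAt ![-(ρ : ℤ), 0, 0] ρ R)ᶜ ^ T.card := hcard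
    rw [e, pow_mul]
    exact pow_le_pow_left₀ measureReal_nonneg hone _


/-! ## Positivity at every aspect -/

/-- **`σ₊^loc · σ₋^loc · (1-p)^{(2L+1)⁶} ≤ α₂(n, L)` for every `p` and every `1 ≤ n < L`** — all pairs `s(q,q')` with `q ∈ Λ(L) ∩ {x₀ = 0}`, `q' ∈ Λ(L)`
closed is an admissible wall for `real_mul_real_mul_le_annulusTwoArmProb` (a plane-to-plane path inside `Λ(L)` visits `{x₀ = 0}` and steps on).
A positivity statement for the small scales. [folklore] -/
theorem real_mul_real_mul_one_sub_pow_le_annulusTwoArmProb (p : unitInterval) {n L : ℕ} (hn : 1 ≤ n) (hnL : n + 1 ≤ L) :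
    (bondPercolation (zdGraph 3) p).real
        (linked (Set.Icc ![(n : ℤ), -(L : ℤ), -(L : ℤ)] ![(L : ℤ), (L : ℤ), (L : ℤ)])
          (Set.Icc ![(n : ℤ), -(n : ℤ), -(n : ℤ)] ![(n : ℤ), (n : ℤ), (n : ℤ)])
          (Set.Icc ![(L : ℤ), -(L : ℤ), -(L : ℤ)] ![(L : ℤ), (L : ℤ), (L : ℤ)])) *
      (bondPercolation (zdGraph 3) p).real
        (linked (Set.Icc ![-(L : ℤ), -(L : ℤ), -(L : ℤ)] ![-(n : ℤ), (L : ℤ), (L : ℤ)])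
          (Set.Icc ![-(n : ℤ), -(n : ℤ), -(n : ℤ)] ![-(n : ℤ), (n : ℤ), (n : ℤ)])
          (Set.Icc ![-(L : ℤ), -(L : ℤ), -(L : ℤ)] ![-(L : ℤ), (L : ℤ), (L : ℤ)])) *
        (1 - (p : ℝ)) ^ ((2 * L + 1) ^ 6) ≤
      annulusTwoArmProb 3 p n L := by
  classical
  -- adapted from `sq_mul_one_sub_pow_le_annulusTwoArmProb` (gen 9): outer radius `L`, localised radial events
  set μ := bondPercolation (zdGraph 3) p with hμ
  set P0 : Finset (Site 3) := (box 3 L).filter (fun x => x 0 = 0) with hP0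
  set F : Finset (Sym2 (Site 3)) := ((P0 ×ˢ box 3 L).image fun q => s(q.1, q.2)) with hF
  set W : Set (BondConfig (Site 3)) := {ω | ∀ e ∈ F, e ∉ ω} with hW
  have hWT : DeterminedBy W (↑F : Set (Sym2 (Site 3))) := determinedBy_forall_notMem F
  have hWm : MeasurableSet W := measurableSet_forall_notMem F
  have hT : ∀ e ∈ (↑F : Set (Sym2 (Site 3))), ∃ x ∈ e, |x 0| < (n : ℤ) := by
    intro e he
    rw [Finset.mem_coe, hF, Finset.mem_image] at he
    obtain ⟨q, hq, rfl⟩ := he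
    rw [Finset.mem_product, hP0, Finset.mem_filter] at hq
    refine ⟨q.1, Sym2.mem_mk_left _ _, ?_⟩
    rw [hq.1.2]; simp; exact_mod_cast hn
  have hkill : ∀ ω, ω ⊆ (zdGraph 3).edgeSet → ω ∈ W → ∀ a b : Site 3, a 0 = -(n : ℤ) → b 0 = n →
      ¬ (openGraph ω ⊓ withinGraph (zdGraph 3) (↑(box 3 L) : Set (Site 3))).Reachable a b := by
    intro ω _ hWω a b ha hb hab
    obtain ⟨q, hq0, -, hqb⟩ := exists_plane_of_reachable ha hb hab
    have hqb_ne : q ≠ b := by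
      intro h; rw [h, hb] at hq0
      have : (1 : ℤ) ≤ n := by exact_mod_cast hn
      omega
    obtain ⟨Wk⟩ := hqb
    cases Wk with
    | nil => exact hqb_ne rfl
    | @cons _ q' _ hadj _ =>
      obtain ⟨hopen, hwithin⟩ := (SimpleGraph.inf_adj _ _ _ _).1 hadj
      rw [withinGraph_adj] at hwithin
      have hmem : s(q, q') ∈ F := by
        rw [hF, Finset.mem_image]
        refine ⟨(q, q'), ?_, rfl⟩
        rw [Finset.mem_product, hP0, Finset.mem_filter]
        exact ⟨⟨Finset.mem_coe.1 hwithin.2.1, hq0⟩, Finset.mem_coe.1 hwithin.2.2⟩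
      exact hWω _ hmem ((openGraph_adj ω q q').1 hopen).1
  have hmain := real_mul_real_mul_le_annulusTwoArmProb p hn hnL hWT hWm hT hkill
  -- `P(W) ≥ (1-p)^{|F|} ≥ (1-p)^{(2L+1)^6}`
  have hcardF : F.card ≤ (2 * L + 1) ^ 6 := by
    have h1 : F.card ≤ (P0 ×ˢ box 3 L).card := Finset.card_image_le
    have h2 : (P0 ×ˢ box 3 L).card = P0.card * (box 3 L).card := Finset.card_product _ _
    have h3 : P0.card ≤ (box 3 L).card := Finset.card_filter_le _ _
    have h4 : (box 3 L).card = (2 * L + 1) ^ 3 := card_box 3 L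
    have h5 : (2 * L + 1) ^ 3 * (2 * L + 1) ^ 3 = (2 * L + 1) ^ 6 := by ring_nf
    calc F.card ≤ P0.card * (box 3 L).card := by rw [← h2]; exact h1
      _ ≤ (box 3 L).card * (box 3 L).card := Nat.mul_le_mul_right _ h3
      _ = (2 * L + 1) ^ 6 := by rw [h4, h5]
  have hp0 : 0 ≤ 1 - (p : ℝ) := by linarith [p.2.2]
  have hp1 : 1 - (p : ℝ) ≤ 1 := by linarith [p.2.1]
  have hWge : (1 - (p : ℝ)) ^ ((2 * L + 1) ^ 6) ≤ μ.real W :=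
    (pow_le_pow_of_le_one hp0 hp1 hcardF).trans (le_bondPercolation_real_forall_notMem (zdGraph 3) p F)
  have h0 : 0 ≤ μ.real
        (linked (Set.Icc ![(n : ℤ), -(L : ℤ), -(L : ℤ)] ![(L : ℤ), (L : ℤ), (L : ℤ)])
          (Set.Icc ![(n : ℤ), -(n : ℤ), -(n : ℤ)] ![(n : ℤ), (n : ℤ), (n : ℤ)])
          (Set.Icc ![(L : ℤ), -(L : ℤ), -(L : ℤ)] ![(L : ℤ), (L : ℤ), (L : ℤ)])) *
      μ.real
        (linked (Set.Icc ![-(L : ℤ), -(L : ℤ), -(L : ℤ)] ![-(n : ℤ), (L : ℤ), (L : ℤ)])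
          (Set.Icc ![-(n : ℤ), -(n : ℤ), -(n : ℤ)] ![-(n : ℤ), (n : ℤ), (n : ℤ)])
          (Set.Icc ![-(L : ℤ), -(L : ℤ), -(L : ℤ)] ![-(L : ℤ), (L : ℤ), (L : ℤ)])) :=
    mul_nonneg measureReal_nonneg measureReal_nonneg
  exact (mul_le_mul_of_nonneg_left hWge h0).trans hmain

end Summit.CriticalPhenomena.PercolationContinuityZ3.Theorems.Rsw3

end
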